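import Summits.HubbardSuperconductivity.HubbardSuperconductivity.Theses.AposterioriCapRg
import Literature.MathematicalPhysics.QuantumLattice.HubbardGrandCanonicalDensity
import Summits.HubbardSuperconductivity.HubbardSuperconductivity.Theorems.WeakCouplingBCSWcbcsBcsConstructionEnergyDensityLimit
import Summits.HubbardSuperconductivity.HubbardSuperconductivity.Theorems.ChiralWindowCwChiralConstructionDensityOfLimits

/-!
# Crux `CapRgSymmetricCertificatePinned` (stmt-HubbardSuperconductivity-14045), line `strict-continuum-certificate-transfer`
# (v4): stub `stub_densityOfBracket` — the density conjunct from a two-point bracket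

Support file (`--supports stmt-HubbardSuperconductivity-14045`; registered stub `stub_densityOfBracket` of the lead's
skeleton v4; no definition).  The crux's density conjunct asks for a chemical potential `μ` at which the grand-canonical
tracial ground-state density `n_{L+1}(U, μ) = Re ω₀[hubbardTorusWith 2 (L+1) 1 U μ](N)/(L+1)²` CONVERGES, to `1 - δ`
with `δ` only window-constrained.  We prove: if at two chemical potentials `μ₁ < μ₂` the densities satisfy
`lo ≤ n_{L+1}(U, μ₁)` and `n_{L+1}(U, μ₂) ≤ hi`, each only FREQUENTLY in `L`, then SOME `μ ∈ (μ₁, μ₂)` has a convergent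
density with limit `d ∈ [lo, hi]` — for EVERY coupling `U`, unconditionally.

Proof, entirely from tree theorems: the grand-canonical ground-state energy density of the 2D Hubbard torus has a
thermodynamic limit `g_U(μ)` for every `U, μ` (`stub_torusGcEnergyDensityLimit`, Theorems of route WeakCouplingBCS:
Fekete along squares + torus/box comparison); `g_U` is antitone (`CwDensity.antitone_of_tendsto`, Theorems of route
ChiralWindow), hence differentiable Lebesgue-a.e. and so at SOME point `μ` of `(μ₁, μ₂)` (`CwDensity.exists_differentiableAt`);
there Griffiths' lemma (`tendsto_gcDensity_of_hasDerivAt`, `Literature/…/HubbardGrandCanonicalDensity.lean`) gives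
`n_{L+1}(U, μ) → -g_U′(μ)`; finally `n_{L+1}(U, μ₁) ≤ n_{L+1}(U, μ) ≤ n_{L+1}(U, μ₂)` at every volume
(`gcNumber_torus_mono`), and a closed half-line met frequently along a convergent sequence contains its limit.
(R. B. Griffiths, J. Math. Phys. 5 (1964) 1215; D. Ruelle, *Statistical Mechanics* (1969) §3.4; Lebesgue.)  The
Literature home of the bracket lemma for general hopping `t` is proposed separately
(`HubbardGrandCanonicalDensityBracket.lean`, p96990).
-/

noncomputable section

namespace Summit.HubbardSuperconductivity.CapRgSymmetricCertificatePinned.StrictContinuum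

open Filter Topology
open Literature.MathematicalPhysics.QuantumLattice Literature.Probability.LatticeModels Matrix

/-- **Stub `stub_densityOfBracket` (density transport).** For every coupling `U` and chemical potentials `μ₁ < μ₂`: if
`lo ≤ n_{L+1}(U, μ₁)` frequently in `L` and `n_{L+1}(U, μ₂) ≤ hi` frequently in `L`, then some `μ ∈ (μ₁, μ₂)` has
`n_{L+1}(U, μ) → d` with `d ∈ [lo, hi]` (a differentiability point of the antitone thermodynamic limit of the
grand-canonical energy density, Griffiths' lemma, and monotone transport of the two one-sided bounds). -/
theorem stub_densityOfBracket : ∀ (U μ₁ μ₂ lo hi : ℝ), μ₁ < μ₂ →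
    (∃ᶠ L : ℕ in atTop, lo ≤
      ((hubbardTorusWith 2 (L + 1) 1 U μ₁).groundStateFunctional totalNumber).re / ((L + 1 : ℕ) : ℝ) ^ 2) →
    (∃ᶠ L : ℕ in atTop,
      ((hubbardTorusWith 2 (L + 1) 1 U μ₂).groundStateFunctional totalNumber).re / ((L + 1 : ℕ) : ℝ) ^ 2 ≤ hi) →
    ∃ μ ∈ Set.Ioo μ₁ μ₂, ∃ d ∈ Set.Icc lo hi,
      Tendsto (fun L : ℕ => ((hubbardTorusWith 2 (L + 1) 1 U μ).groundStateFunctional totalNumber).re /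
        ((L + 1 : ℕ) : ℝ) ^ 2) atTop (𝓝 d) := by
  intro U μ₁ μ₂ lo hi h12 hlo hhi
  choose g hg using Summit.HubbardSuperconductivity.HubbardSuperconductivity.Theorems.stub_torusGcEnergyDensityLimit U
  obtain ⟨μ, hμ, hdiff⟩ :=
    Summit.HubbardSuperconductivity.HubbardSuperconductivity.Theorems.CwDensity.exists_differentiableAt
      (Summit.HubbardSuperconductivity.HubbardSuperconductivity.Theorems.CwDensity.antitone_of_tendsto hg) h12
  have hlim := tendsto_gcDensity_of_hasDerivAt 1 U μ (Eventually.of_forall hg) hdiff.hasDerivAt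
  refine ⟨μ, hμ, -deriv g μ, ⟨?_, ?_⟩, hlim⟩
  · refine isClosed_Ici.mem_of_frequently_of_tendsto (hlo.mono fun L hL => ?_) hlim
    exact hL.trans (div_le_div_of_nonneg_right (gcNumber_torus_mono (L + 1) 1 U hμ.1.le) (by positivity))
  · refine isClosed_Iic.mem_of_frequently_of_tendsto (hhi.mono fun L hL => ?_) hlim
    exact (div_le_div_of_nonneg_right (gcNumber_torus_mono (L + 1) 1 U hμ.2.le) (by positivity)).trans hL

end Summit.HubbardSuperconductivity.CapRgSymmetricCertificatePinned.StrictContinuum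

end
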